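import Literature.MathematicalPhysics.QuantumFieldTheory.Balaban1983to89.Node00.BgCarriersOfRecordLit
import Literature.MathematicalPhysics.QuantumFieldTheory.Balaban1983to89.B9Eq310HessianOperator
import Literature.MathematicalPhysics.QuantumFieldTheory.Balaban1983to89.B11Eq103H1Complex

/-!
# `Balaban1983to89.Node00.BgLettersOfRecord` — THE LETTERS OF [B11] (110)–(111) PINNED AT THE RECORD, UP TO THE AVERAGING DATA:
# the record's Hilbert fibre `ℂ^{N×N}` (`⟨X, Y⟩ = tr X*Y`) identified with `M_N(ℂ)`, the transporters `R(U₀(b))` on it and their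
# adjointness (PROVED: unitarity of `SU(N)`), the Hessian `Δ₁(U₀) = Δ^η(U₀) = D*D + Δ′` of [B9] (3.10) at the record, the restriction
# `R` of (3.21), (110)'s `Δ_{1,a}(U₀)`, and `𝔊(U₀)`, `H₁(U₀)` in the type of (115) — lit's CONSTRUCTED letters instantiated; the bond
# averaging `Q`, the site averaging `Q′`, the constant `a` stay DATA and the two facts `hpos` ([B9] Thm 3.11), `hQ` (onto) stay DISPLAYED
# — OURS (definitional + two bookkeeping theorems; file 3a of the record-pinned instance road `M1`, no inequality of Bałaban)

CITATION HEADER (LEAF RULE: pointers BY NAME only).  [Balaban1985BackgroundPropagators] = T. Bałaban, *Commun. Math. Phys.* **99** (1985)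
389–434: p. 390 (`R(U)X = UXU⁻¹`, after (3.1)), (3.3) p. 390–391, (3.8)–(3.11) p. 392 («the adjoints are taken with respect to natural L²
scalar products for functions with values in N × N hermitian matrices … X·Y = tr XY»), (3.19)/(3.21) pp. 393–394, Thm 3.11 p. 395;
[Balaban1985Variational] = *Commun. Math. Phys.* **102** (1985) 277–309: (45) p. 285, (103) p. 293, (110)–(111) p. 294, (115)–(117)
pp. 294–295; [Balaban1985Averaging] (18)–(19) p. 21 (the two normings of the `𝔤ᶜ`-valued functions); [Balaban1987RG1] (0.1) p. 251,
(1.1) p. 260 (the record: `η = L^{-k}`, the torus).  Tree inputs, by name: `B9Eq310HessianOperator.{adTransportW, adTransportW_apply,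
principalOpK, principalOpK_isSymmetric, curvOp, hessOp, toAlg, inner_eq_sum_trace}` ([B9] (3.10) as an operator), `B11Eq103H1Complex.{SiteL2K,
BondL2K, covDerivL2K, covDivL2K, RLatticeK, RLatticeK_isSymmetric, laplaceALatticeK, laplaceALatticeK_eq_adjoint_form, G1LatticeK,
KinvLatticeK, G1Fun, QFun, QadjFun, DFun, DstarFun, frakGLatticeCLM, H1LatticeCLM}` (the constructed letters and their (115)-typed readings),
`B9Eq311L2Pairing.WL2` (weighted `L²`), `B11Eq111FrakG.{nabla115, frakG}`, `B11Eq115Space.{Space115, NegSize}`, `Node00.BgCarriersOfRecord.{factL,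
factEta}`, `Node00.BgCarriersOfRecordLit.{bondToLit, unitsOfRecord, pairLevLit, Space115Lit, NegSizeLit, BgSchemeOnLit}`, `Setup.{Site, PBond,
GaugeField, Params.eta, Params.d, Params.sitesPerDir}`, `Node00.DatumAvLayer.SU`; Mathlib's `EuclideanSpace`, `WithLp.toLp`, `Matrix.of`,
`Matrix.traceLinearMap`, `Matrix.trace_mul_comm`, `PiLp.inner_apply`, and the `L²`-operator norm on `Matrix (Fin N) (Fin N) ℂ` opened by
`open scoped Matrix.Norms.L2Operator` as in `Node00.CarriersB12Chart` / `Node00.BgCarriersOfRecord` (no instance is declared in this file).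

WHAT THIS MODULE DOES (pub-ymgap bus CORRECTION + INTENT-5, I.22915).  `Node00.BgCarriersOfRecordLit` typed the carriers of [B11] Prop. 6's
record instance on lit's lattice carrier and plugged `𝔊` as FREE letters (`frakGOfLetters`).  Lit has meanwhile CONSTRUCTED those letters from
lattice data: `G₁ = (Δ_{1,a})⁻¹`, `(QG₁Q*)⁻¹`, `𝔓 = 1 − Q*(QG₁Q*)⁻¹QG₁ − DRD*G₁`, `𝔊 = 𝔓G₁`, `H₁ = G₁Q*(QG₁Q*)⁻¹` on the complex weighted `L²`
spaces `BondL2K ℂ d Pd c₀ W` (`B11Eq103H1Complex`), the Hessian `Δ^η(U) = D*D + Δ′` as an operator of the background (`B9Eq310HessianOperator.hessOp`)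
and the restriction `R` of (3.21) from the site averaging (`RLatticeK`).  This file instantiates them AT THE RECORD:
* §1 the Hilbert fibre `WRec N := EuclideanSpace ℂ (Fin N × Fin N)` with `phiRec N : WRec N ≃ₗ[ℂ] M_N(ℂ)` (entries ↦ matrix), the trace
  `tauRec N`, and **`inner_phiRec_symm`**: `⟨φ⁻¹X, φ⁻¹Y⟩ = tr(X*Y)` — the compatibility `hτ` under which lit's `curvOp` IS print's `Δ′` and the
  `L²` product IS `Σ_b η^d tr(A(b)*B(b))` ((18)/(3.11); `inner_bondL2_eq_sum_trace`);
* §2 the constants `c0Rec F K k = η_k^d` (the `L²` weight; `factC0`) and `cRec F K k = η_k⁻¹` (the difference-quotient scalar; `conj_cRec`);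
* §3 the transporters `RRec F N U₀ = R(U₀(b))`, `SRec F N U₀ = R(U₀(b)⁻¹)` on `WRec N` (lit's `adTransportW phiRec (unitsOfRecord U₀)`) and
  **`inner_RRec_left`**: `⟨R(U₀(b))v, u⟩ = ⟨v, R(U₀(b)⁻¹)u⟩` — the displayed hypothesis `hRS` of `principalOpK_isSymmetric`,
  `adjoint_covDerivL2K`, `laplaceALatticeK_isSymmetric` DISCHARGED at the record (`U₀(b)⁻¹ = U₀(b)*`, cyclicity of `tr`);
* §4 **`hessOpOfRecord F N k U₀ := hessOp phiRec η_k (unitsOfRecord U₀) tr`** = `Δ₁(U₀)` at the record, `principalOpOfRecord_isSymmetric`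
  (hypothesis-free);
* §5 `RrOfRecord … Q′ := RLatticeK η_k⁻¹ RRec SRec Q′` (symmetric), **`laplaceAOfRecord … Q Q′ a`** = (110)'s `Δ_{1,a}(U₀)` with
  `laplaceAOfRecord_eq_adjoint_form` (`= Δ₁ + D∘R∘D† + Q†∘(aQ)`, hypothesis-free), and — with the two DISPLAYED proofs `hpos`
  (`re⟨x, Δ_{1,a}(U₀)x⟩ > 0`, [B9] Thm 3.11 at the record) and `hQ` (`Q` onto) — **`frakGOfRecord F N K k Ω U₀ Q Q′ a hpos hQ :
  NegSizeLit F N K k Ω 3 →L[ℂ] Space115Lit F N K k Ω U₀`** (= lit's `frakGLatticeCLM` at the record; its type IS the `𝒢`-slot of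
  `BgSchemeOnLit F N K k Ω U₀`; `frakGOfRecord_eq_frakG` (`rfl`) names the constructed letters it carries) and `H1OfRecord` (the (L6) letter).
HONEST LABELS.  (1) DEFINITIONAL/BOOKKEEPING: the only theorems are the trace identity of §1, the adjointness of §3 and `rfl`/by-name
consequences; no inequality of Bałaban ((117), Thm 3.11, Prop. 6) is proved or assumed.  (2) DATA LEFT: the bond averaging `Q` ((3.19)/(44) at
`U₀`, a linear map `BondL2K → WL2 ℂ wB W` — the record's `Q_k(U₀)` exists as `Node00.LinearisedAveragingAtBackground.dIterL` in the
left-trivialised real-linear reading; its transcription into this slot is a separate typing job), the site averaging `Q′`, the constant `a`, the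
block levels `levB`; and the PROOFS `hpos`, `hQ`.  (3) NOT HERE: the (117) socket's constants for `phiRec` (operator norm vs. entrywise norm on
`M_N(ℂ)`), the derivative `W` of the record functional in the chart, the current `J`, `𝔄 := hOp`, the background composite `bg` — the remaining
slots of `Node00.BackgroundMapOfRecord.BgScheme` (M1 file 3).  (4) CARRIER FORK F1 kept (one carrier per background `U₀`).
-/

noncomputable section

open scoped Matrix.Norms.L2Operator InnerProductSpace ComplexConjugate

namespace Literature.MathematicalPhysics.QuantumFieldTheory.Balaban1983to89.Node00

open T4Continuum (T4Family)
open B4Sect5Torus (TSite)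
open B9SectCLatticeCarrier (Bond)
open B9Eq311L2Pairing (WL2)
open B9Eq310HessianOperator (adTransportW adTransportW_apply principalOpK principalOpK_isSymmetric curvOp hessOp)
open B11Eq103H1Complex (SiteL2K BondL2K laplaceALatticeK RLatticeK frakGLatticeCLM H1LatticeCLM)
open B11Eq111FrakG (nabla115)
open B11Eq115Space (Space115 NegSize)

/-! ## §1. The record's Hilbert fibre `W = ℂ^{N×N}` with `⟨X, Y⟩ = tr X*Y`, read in `M_N(ℂ)` -/

section Fibre

variable (N : ℕ)

/-- The Hilbert fibre of record: matrix ENTRIES with the Euclidean scalar product (print's `X·Y = tr X*Y`).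
[cite: Balaban1985Averaging, (18) p.21; Balaban1985BackgroundPropagators, p.391] -/
abbrev WRec : Type := EuclideanSpace ℂ (Fin N × Fin N)

/-- The fibre identification `φ : W ≃ₗ[ℂ] M_N(ℂ)` of record: entries ↦ matrix (the two normings (18)/(19) of ONE space).
[cite: Balaban1985Averaging, (18)–(19) p.21] -/
def phiRec : WRec N ≃ₗ[ℂ] Matrix (Fin N) (Fin N) ℂ where
  toFun x := Matrix.of fun i j => x (i, j)
  invFun X := WithLp.toLp 2 fun p => X p.1 p.2
  map_add' _ _ := rfl
  map_smul' _ _ := rfl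
  left_inv _ := rfl
  right_inv _ := rfl

variable {N} in
/-- Unfolding an entry. [cite: Balaban1985Averaging, (18)–(19) p.21] -/
theorem phiRec_apply (x : WRec N) (i j : Fin N) : phiRec N x i j = x (i, j) := rfl

variable {N} in
/-- Unfolding the inverse. [cite: Balaban1985Averaging, (18)–(19) p.21] -/
theorem phiRec_symm_apply (X : Matrix (Fin N) (Fin N) ℂ) (p : Fin N × Fin N) : (phiRec N).symm X p = X p.1 p.2 := rfl

/-- The trace of record `τ = tr : M_N(ℂ) →ₗ[ℂ] ℂ`. [cite: Balaban1985BackgroundPropagators, p.391] -/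
abbrev tauRec : Matrix (Fin N) (Fin N) ℂ →ₗ[ℂ] ℂ := Matrix.traceLinearMap (Fin N) ℂ ℂ

variable {N} in
/-- **The compatibility `⟨φ⁻¹X, φ⁻¹Y⟩ = tr(X*Y)`** (the `hτ` of `B9Eq310HessianOperator.inner_eq_sum_trace`): the Euclidean product of the
entries IS print's `X·Y = tr X*Y`. [cite: Balaban1985BackgroundPropagators, p.391; Balaban1985Averaging, (18) p.21] -/
theorem inner_phiRec_symm (X Y : Matrix (Fin N) (Fin N) ℂ) :
    ⟪(phiRec N).symm X, (phiRec N).symm Y⟫_ℂ = tauRec N (star X * Y) := by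
  rw [PiLp.inner_apply, Matrix.traceLinearMap_apply, Matrix.star_eq_conjTranspose, Matrix.trace, Fintype.sum_prod_type,
    Finset.sum_comm]
  refine Finset.sum_congr rfl fun j _ => ?_
  rw [Matrix.diag_apply, Matrix.mul_apply]
  refine Finset.sum_congr rfl fun i _ => ?_
  rw [Matrix.conjTranspose_apply, RCLike.inner_apply', RCLike.star_def]
  rfl

end Fibre

/-! ## §2. Constants of record: the `L²` weight `c₀ = η^d` and the difference-quotient scalar `η⁻¹` -/

section Constants

variable (F : T4Family) (K k : ℕ)

/-- `c₀ = η^d`, the uniform weight of the `L²` scalar products (3.11) at the record's `η = L^{-k}`.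
[cite: Balaban1985BackgroundPropagators, (3.11) p.392; Balaban1987RG1, (1.1) p.260] -/
def c0Rec : ℝ := (F.P K).eta k ^ (F.P K).d

/-- `0 < η^d`. [cite: Balaban1987RG1, (1.1) p.260] -/
theorem c0Rec_pos : 0 < c0Rec F K k := pow_pos (factEta F K k).out _

/-- `Fact (0 < c₀)` FOUND (a theorem; bind with `haveI`). [cite: Balaban1987RG1, (1.1) p.260] -/
theorem factC0 : Fact (0 < c0Rec F K k) := ⟨c0Rec_pos F K k⟩

/-- `η⁻¹` as a complex scalar (the `c` of `covDerivL2K c R`, (3.3)). [cite: Balaban1985BackgroundPropagators, (3.3) p.390] -/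
def cRec : ℂ := (((F.P K).eta k : ℝ) : ℂ)⁻¹

/-- `η⁻¹` is real: `conj c = c` (the `hc` of `adjoint_covDerivL2K`). [cite: Balaban1985BackgroundPropagators, (3.8) p.392] -/
theorem conj_cRec : conj (cRec F K k) = cRec F K k := by
  rw [cRec, map_inv₀, Complex.conj_ofReal]

end Constants

/-! ## §3. The transporters of record on the Hilbert fibre and their adjointness -/

section Transporters

variable (F : T4Family) (N : ℕ) {K : ℕ}

/-- `R(U₀(b))` read on `W` along `φ`: `w ↦ φ⁻¹(U₀(b) · φw · U₀(b)⁻¹)`. [cite: Balaban1985BackgroundPropagators, p.390, (3.3) p.391] -/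
def RRec (U₀ : GaugeField (F.P K) 0 (SU N)) : Bond (F.P K).d (fun _ => (F.P K).sitesPerDir 0) → WRec N →ₗ[ℂ] WRec N :=
  adTransportW (phiRec N) (unitsOfRecord F N U₀)

/-- The adjoint transporters `R(U₀(b)⁻¹)` (those of the cocurl/divergence (3.8)–(3.9)). [cite: Balaban1985BackgroundPropagators, (3.8)–(3.9) p.392] -/
def SRec (U₀ : GaugeField (F.P K) 0 (SU N)) : Bond (F.P K).d (fun _ => (F.P K).sitesPerDir 0) → WRec N →ₗ[ℂ] WRec N :=
  adTransportW (phiRec N) (fun a => (unitsOfRecord F N U₀ a)⁻¹)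

variable {F N}

/-- Unfolding `R(U₀(b))w`. [cite: Balaban1985BackgroundPropagators, p.390] -/
theorem RRec_apply (U₀ : GaugeField (F.P K) 0 (SU N)) (a : Bond (F.P K).d (fun _ => (F.P K).sitesPerDir 0)) (w : WRec N) :
    RRec F N U₀ a w = (phiRec N).symm ((unitsOfRecord F N U₀ a : Matrix (Fin N) (Fin N) ℂ) * phiRec N w *
      ((unitsOfRecord F N U₀ a)⁻¹ : (Matrix (Fin N) (Fin N) ℂ)ˣ)) :=
  adTransportW_apply _ _ _ _

/-- Unfolding `R(U₀(b)⁻¹)w`. [cite: Balaban1985BackgroundPropagators, p.390] -/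
theorem SRec_apply (U₀ : GaugeField (F.P K) 0 (SU N)) (a : Bond (F.P K).d (fun _ => (F.P K).sitesPerDir 0)) (w : WRec N) :
    SRec F N U₀ a w = (phiRec N).symm (((unitsOfRecord F N U₀ a)⁻¹ : (Matrix (Fin N) (Fin N) ℂ)ˣ) * phiRec N w *
      (unitsOfRecord F N U₀ a : Matrix (Fin N) (Fin N) ℂ)) := by
  rw [SRec, adTransportW_apply, inv_inv]

/-- The unit of record at a lit bond is `U₀` at the record bond. [cite: Balaban1985BackgroundPropagators, (3.3) p.391] -/
theorem coe_unitsOfRecord (U₀ : GaugeField (F.P K) 0 (SU N)) (a : Bond (F.P K).d (fun _ => (F.P K).sitesPerDir 0)) :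
    (unitsOfRecord F N U₀ a : Matrix (Fin N) (Fin N) ℂ) = (U₀ ((bondToLit (F.P K) 0).symm a) : Matrix (Fin N) (Fin N) ℂ) := rfl

/-- Its inverse is the adjoint matrix (`U₀(b) ∈ SU(N)`). [cite: Balaban1985BackgroundPropagators, (3.5) p.391] -/
theorem coe_unitsOfRecord_inv (U₀ : GaugeField (F.P K) 0 (SU N)) (a : Bond (F.P K).d (fun _ => (F.P K).sitesPerDir 0)) :
    ((unitsOfRecord F N U₀ a)⁻¹ : (Matrix (Fin N) (Fin N) ℂ)ˣ) = star (U₀ ((bondToLit (F.P K) 0).symm a) : Matrix (Fin N) (Fin N) ℂ) := rfl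

/-- **The transporters of record are mutually adjoint on the Hilbert fibre** (`hRS`): `⟨R(U₀(b))v, u⟩ = ⟨v, R(U₀(b)⁻¹)u⟩` — unitarity of
`U₀(b) ∈ SU(N)` and cyclicity of the trace («the adjoints are taken with respect to natural L² scalar products … X·Y = tr XY»).
[cite: Balaban1985BackgroundPropagators, (3.8) p.392, p.391] -/
theorem inner_RRec_left (U₀ : GaugeField (F.P K) 0 (SU N)) (a : Bond (F.P K).d (fun _ => (F.P K).sitesPerDir 0)) (v u : WRec N) :
    ⟪RRec F N U₀ a v, u⟫_ℂ = ⟪v, SRec F N U₀ a u⟫_ℂ := by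
  set g : Matrix (Fin N) (Fin N) ℂ := (U₀ ((bondToLit (F.P K) 0).symm a) : Matrix (Fin N) (Fin N) ℂ) with hg
  have hv : v = (phiRec N).symm (phiRec N v) := ((phiRec N).symm_apply_apply v).symm
  have hu : u = (phiRec N).symm (phiRec N u) := ((phiRec N).symm_apply_apply u).symm
  rw [RRec_apply, SRec_apply, coe_unitsOfRecord, coe_unitsOfRecord_inv, ← hg]
  conv_lhs => rw [hu]
  conv_rhs => rw [hv]
  rw [inner_phiRec_symm, inner_phiRec_symm]
  simp only [star_mul, star_star, Matrix.traceLinearMap_apply, mul_assoc]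
  rw [Matrix.trace_mul_comm]
  simp only [mul_assoc]

end Transporters

/-! ## §4. The Hessian of record `Δ₁(U₀) = Δ^η(U₀) = D*D + Δ′` on the `L²` bond space -/

section Hessian

variable (F : T4Family) (N : ℕ) {K : ℕ} (k : ℕ)

/-- **`Δ₁(U₀)` AT THE RECORD**: [B9] (3.10)'s Hessian `Δ^η(U₀) = D*D + Δ′` as an operator on the `L²` space of `M_N(ℂ)`-entry-valued bond
functions of the record's lattice, at `η = η_k`, background `unitsOfRecord U₀`, trace `tr`, fibre identification `phiRec`.
[cite: Balaban1985BackgroundPropagators, (3.10) p.392; Balaban1985Variational, (110) p.294] -/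
def hessOpOfRecord [Fact (0 < c0Rec F K k)] (U₀ : GaugeField (F.P K) 0 (SU N)) :
    BondL2K ℂ (F.P K).d (fun _ => (F.P K).sitesPerDir 0) (c0Rec F K k) (WRec N) →ₗ[ℂ]
      BondL2K ℂ (F.P K).d (fun _ => (F.P K).sitesPerDir 0) (c0Rec F K k) (WRec N) :=
  hessOp (phiRec N) ((F.P K).eta k) (unitsOfRecord F N U₀) (tauRec N)

variable {F N k}

/-- Unfolding `Δ₁(U₀) = D*D + Δ′` at the record. [cite: Balaban1985BackgroundPropagators, (3.10) p.392] -/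
theorem hessOpOfRecord_eq [Fact (0 < c0Rec F K k)] (U₀ : GaugeField (F.P K) 0 (SU N)) :
    hessOpOfRecord F N k U₀ =
      principalOpK (phiRec N) ((F.P K).eta k) (unitsOfRecord F N U₀) + curvOp (phiRec N) (tauRec N) ((F.P K).eta k) (unitsOfRecord F N U₀) := rfl

/-- **The principal part `D*D` of the record's Hessian is SYMMETRIC, hypothesis-free** (`hRS` discharged by `inner_RRec_left`).
[cite: Balaban1985BackgroundPropagators, (3.10) p.392] -/
theorem principalOpOfRecord_isSymmetric [Fact (0 < c0Rec F K k)] (U₀ : GaugeField (F.P K) 0 (SU N)) :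
    (principalOpK (c₀ := c0Rec F K k) (phiRec N) ((F.P K).eta k) (unitsOfRecord F N U₀)).IsSymmetric :=
  principalOpK_isSymmetric _ _ _ (inner_RRec_left U₀)

/-- The record's `L²` scalar product IS print's `Σ_b η^d tr(A(b)*B(b))` ((3.11) with (18)). [cite: Balaban1985BackgroundPropagators, (3.11) p.392; Balaban1985Averaging, (18) p.21] -/
theorem inner_bondL2_eq_sum_trace [Fact (0 < c0Rec F K k)]
    (f g : BondL2K ℂ (F.P K).d (fun _ => (F.P K).sitesPerDir 0) (c0Rec F K k) (WRec N)) :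
    ⟪f, g⟫_ℂ = ∑ b, (c0Rec F K k : ℂ) * tauRec N (star (B9Eq310HessianOperator.toAlg (phiRec N) f b) * B9Eq310HessianOperator.toAlg (phiRec N) g b) :=
  B9Eq310HessianOperator.inner_eq_sum_trace (phiRec N) (tauRec N) inner_phiRec_symm f g

end Hessian

/-! ## §5. (110)'s `Δ_{1,a}(U₀)`, and `𝔊`, `H₁` of record in the type of (115) — data `Q`, `Q′`, `a`; displayed `hpos`, `hQ` -/

section Letters

variable (F : T4Family) (N : ℕ) {K : ℕ} (k : ℕ) (Ω : ℕ → Set (Site (F.P K) 0)) (U₀ : GaugeField (F.P K) 0 (SU N))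
  {β : Type*} [Fintype β] {wB : β → ℝ} [Fact (∀ y, 0 < wB y)] {F' : Type*} [AddCommGroup F'] [Module ℂ F']

/-- **The restriction `R` of (3.21) AT THE RECORD**, constructed from a site-averaging datum `Q′` (lit's `RLatticeK`: the orthogonal projection onto
`Δ^η_{U₀} N(Q′)`). [cite: Balaban1985BackgroundPropagators, (3.21)–(3.23) p.394] -/
def RrOfRecord [Fact (0 < c0Rec F K k)]
    (Q' : SiteL2K ℂ (F.P K).d (fun _ => (F.P K).sitesPerDir 0) (c0Rec F K k) (WRec N) →ₗ[ℂ] F') :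
    SiteL2K ℂ (F.P K).d (fun _ => (F.P K).sitesPerDir 0) (c0Rec F K k) (WRec N) →ₗ[ℂ]
      SiteL2K ℂ (F.P K).d (fun _ => (F.P K).sitesPerDir 0) (c0Rec F K k) (WRec N) :=
  RLatticeK (cRec F K k) (RRec F N U₀) (SRec F N U₀) Q'

/-- The record's `R` is symmetric (the `hR` of `laplaceALatticeK_isSymmetric`, discharged). [cite: Balaban1985BackgroundPropagators, (3.21) p.394] -/
theorem RrOfRecord_isSymmetric [Fact (0 < c0Rec F K k)]
    (Q' : SiteL2K ℂ (F.P K).d (fun _ => (F.P K).sitesPerDir 0) (c0Rec F K k) (WRec N) →ₗ[ℂ] F') :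
    (RrOfRecord F N k U₀ Q').IsSymmetric :=
  B11Eq103H1Complex.RLatticeK_isSymmetric _ _ _ _

/-- **(110)'s `Δ_{1,a}(U₀) = Δ₁ + DRD* + aQ*Q` AT THE RECORD** — `Δ₁ := hessOpOfRecord`, `D := (3.3)`, `D* := (3.8)` with the record's transporters,
`R := RrOfRecord Q′`; the bond averaging `Q` ((3.19) at `U₀`), the site averaging `Q′` and `a` are DATA.
[cite: Balaban1985Variational, (110) p.294; Balaban1985BackgroundPropagators, (3.26) p.395] -/
abbrev laplaceAOfRecord [Fact (0 < c0Rec F K k)]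
    (Q : BondL2K ℂ (F.P K).d (fun _ => (F.P K).sitesPerDir 0) (c0Rec F K k) (WRec N) →ₗ[ℂ] WL2 ℂ wB (WRec N))
    (Q' : SiteL2K ℂ (F.P K).d (fun _ => (F.P K).sitesPerDir 0) (c0Rec F K k) (WRec N) →ₗ[ℂ] F') (a : ℝ) :
    BondL2K ℂ (F.P K).d (fun _ => (F.P K).sitesPerDir 0) (c0Rec F K k) (WRec N) →ₗ[ℂ]
      BondL2K ℂ (F.P K).d (fun _ => (F.P K).sitesPerDir 0) (c0Rec F K k) (WRec N) :=
  laplaceALatticeK (cRec F K k) (RRec F N U₀) (SRec F N U₀) (hessOpOfRecord F N k U₀) (RrOfRecord F N k U₀ Q') Q a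

variable {F N k U₀}

/-- `Δ_{1,a}(U₀) = Δ₁ + D ∘ R ∘ D† + Q† ∘ (aQ)` at the record: the `D*` slot IS the Hilbert adjoint (`hc`, `hRS` discharged here).
[cite: Balaban1985BackgroundPropagators, (3.8) p.392; Balaban1985Variational, (110) p.294] -/
theorem laplaceAOfRecord_eq_adjoint_form [Fact (0 < c0Rec F K k)]
    (Q : BondL2K ℂ (F.P K).d (fun _ => (F.P K).sitesPerDir 0) (c0Rec F K k) (WRec N) →ₗ[ℂ] WL2 ℂ wB (WRec N))
    (Q' : SiteL2K ℂ (F.P K).d (fun _ => (F.P K).sitesPerDir 0) (c0Rec F K k) (WRec N) →ₗ[ℂ] F') (a : ℝ) :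
    laplaceAOfRecord F N k U₀ Q Q' a =
      hessOpOfRecord F N k U₀ +
        B11Eq103H1Complex.covDerivL2K ℂ (c0Rec F K k) (cRec F K k) (RRec F N U₀) ∘ₗ RrOfRecord F N k U₀ Q' ∘ₗ
          LinearMap.adjoint (B11Eq103H1Complex.covDerivL2K ℂ (c0Rec F K k) (cRec F K k) (RRec F N U₀)) +
        LinearMap.adjoint Q ∘ₗ ((a : ℂ) • Q) :=
  B11Eq103H1Complex.laplaceALatticeK_eq_adjoint_form (conj_cRec F K k) (inner_RRec_left U₀)

variable (F N k U₀)

variable (K) in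
/-- **`𝔊(U₀)` OF RECORD IN THE TYPE OF (115)/(116)–(117)**: lit's `frakGLatticeCLM` (constructed letters `G₁`, `(QG₁Q*)⁻¹`, `𝔓`) at the record's
fibre, transporters, Hessian and restriction; DATA `Q`, `Q′`, `a`; DISPLAYED proofs `hpos` ([B9] Thm 3.11 at the record) and `hQ` (`Q` onto, (3.19)).
Its type IS the `𝒢`-slot of `BgSchemeOnLit F N K k Ω U₀`.
[cite: Balaban1985Variational, (110)–(111) p.294, (116)–(117) p.295; Balaban1985BackgroundPropagators, Thm 3.11 p.395, (3.19) p.393] -/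
def frakGOfRecord [Fact (0 < (F.L : ℝ))] [Fact (0 < (F.P K).eta k)] [Fact (0 < c0Rec F K k)]
    (Q : BondL2K ℂ (F.P K).d (fun _ => (F.P K).sitesPerDir 0) (c0Rec F K k) (WRec N) →ₗ[ℂ] WL2 ℂ wB (WRec N))
    (Q' : SiteL2K ℂ (F.P K).d (fun _ => (F.P K).sitesPerDir 0) (c0Rec F K k) (WRec N) →ₗ[ℂ] F') (a : ℝ)
    (hpos : ∀ x, x ≠ 0 → 0 < RCLike.re ⟪x, laplaceAOfRecord F N k U₀ Q Q' a x⟫_ℂ) (hQ : Function.Surjective Q) :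
    NegSizeLit F N K k Ω 3 →L[ℂ] Space115Lit F N K k Ω U₀ :=
  frakGLatticeCLM (phiRec N) hpos hQ (pairLevLit F Ω k) (nabla115 ((F.P K).eta k) (unitsOfRecord F N U₀))

variable (K) in
/-- **`H₁(U₀)` OF RECORD IN THE TYPE OF (115)** (the (L6) letter `G₁Q*(QG₁Q*)⁻¹` read on the functions), block levels `levB` a datum.
[cite: Balaban1985Variational, (45) p.285, (103) p.293, (174) p.305] -/
def H1OfRecord [Fact (0 < (F.L : ℝ))] [Fact (0 < (F.P K).eta k)] [Fact (0 < c0Rec F K k)] (levB : β → ℕ)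
    (Q : BondL2K ℂ (F.P K).d (fun _ => (F.P K).sitesPerDir 0) (c0Rec F K k) (WRec N) →ₗ[ℂ] WL2 ℂ wB (WRec N))
    (Q' : SiteL2K ℂ (F.P K).d (fun _ => (F.P K).sitesPerDir 0) (c0Rec F K k) (WRec N) →ₗ[ℂ] F') (a : ℝ)
    (hpos : ∀ x, x ≠ 0 → 0 < RCLike.re ⟪x, laplaceAOfRecord F N k U₀ Q Q' a x⟫_ℂ) (hQ : Function.Surjective Q) :
    NegSize (F.L : ℝ) ((F.P K).eta k) levB 0 (Matrix (Fin N) (Fin N) ℂ) →L[ℂ] Space115Lit F N K k Ω U₀ :=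
  H1LatticeCLM (phiRec N) hpos hQ (pairLevLit F Ω k) (nabla115 ((F.P K).eta k) (unitsOfRecord F N U₀))

variable (K) in
/-- **THE `𝒢`-SLOT PINNED UP TO `Q, Q′, a, hpos, hQ`**: `frakGOfRecord` is `BgCarriersOfRecordLit.frakGOfLetters` at lit's CONSTRUCTED letters
(by `rfl`: both are `B11Eq111FrakG.frakG …`). [cite: Balaban1985Variational, (111) p.294] -/
theorem frakGOfRecord_eq_frakG [Fact (0 < (F.L : ℝ))] [Fact (0 < (F.P K).eta k)] [Fact (0 < c0Rec F K k)]
    (Q : BondL2K ℂ (F.P K).d (fun _ => (F.P K).sitesPerDir 0) (c0Rec F K k) (WRec N) →ₗ[ℂ] WL2 ℂ wB (WRec N))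
    (Q' : SiteL2K ℂ (F.P K).d (fun _ => (F.P K).sitesPerDir 0) (c0Rec F K k) (WRec N) →ₗ[ℂ] F') (a : ℝ)
    (hpos : ∀ x, x ≠ 0 → 0 < RCLike.re ⟪x, laplaceAOfRecord F N k U₀ Q Q' a x⟫_ℂ) (hQ : Function.Surjective Q) :
    frakGOfRecord F N K k Ω U₀ Q Q' a hpos hQ =
      B11Eq111FrakG.frakG (pairLevLit F Ω k) (nabla115 ((F.P K).eta k) (unitsOfRecord F N U₀))
        (B11Eq103H1Complex.G1Fun (phiRec N) (B11Eq103H1Complex.G1LatticeK hpos)) (B11Eq103H1Complex.QFun (phiRec N) Q)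
        (B11Eq103H1Complex.QadjFun (phiRec N) Q) (B11Eq103H1Complex.KinvLatticeK hpos hQ)
        (B11Eq103H1Complex.DFun (phiRec N) (B11Eq103H1Complex.covDerivL2K ℂ (c0Rec F K k) (cRec F K k) (RRec F N U₀)))
        (RrOfRecord F N k U₀ Q') (B11Eq103H1Complex.DstarFun (phiRec N) (B11Eq103H1Complex.covDivL2K ℂ (c0Rec F K k) (cRec F K k) (SRec F N U₀))) :=
  rfl

end Letters

end Literature.MathematicalPhysics.QuantumFieldTheory.Balaban1983to89.Node00

end
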